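import Literature.Analysis.SpecialFunctions.RiemannThetaDiagonal
import Mathlib.LinearAlgebra.Matrix.PosDef
import HarnessLib

/-!
# The theta function of a decomposable period matrix: `ϑ(z, Ω₁ ⊕ Ω₂) = ϑ(z₁, Ω₁) · ϑ(z₂, Ω₂)`

Layer `Literature/Analysis/SpecialFunctions` (lane `lit-hodgefound`, Layer A4, the theta divisor of a
product of principally polarised abelian varieties; sequel of `RiemannThetaDiagonal.lean`, which is the
case of `1 × 1` blocks). For `Ω₁ ∈ ℌ_{n₁}`, `Ω₂ ∈ ℌ_{n₂}` the block-diagonal ("decomposable") period matrix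

  `Ω₁ ⊕ Ω₂ = (Ω₁ 0; 0 Ω₂) ∈ ℌ_{n₁+n₂}`

(here `Matrix.reindex finSumFinEquiv finSumFinEquiv (Matrix.fromBlocks Ω₁ 0 0 Ω₂)`, a matrix indexed by
`Fin (n₁ + n₂)`) is the period matrix of the product `(X_{Ω₁}, Θ₁) × (X_{Ω₂}, Θ₂)` of the principally
polarised Siegel tori, and the Riemann theta function factorises:

* S. Grushevsky, Y. Xie, *Integrable systems approach to the Schottky problem and related questions*
  (2025), Remark 6.2 (held text `paper:arxiv-2504.20243`, chunk p0034): "if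
  `(A, Θ) = (A′, Θ′) × (A″, Θ″)`, then the theta divisor `Θ = (Θ′ × A″) ∪ (A′ × Θ″)` is reducible, the
  theta function is the product `θ(τ, z) = θ′(τ′, z′) · θ(τ″, z″)`, and the singular locus of the theta
  divisor `Sing Θ` contains a `(g − 2)`-dimensional subvariety `Θ′ × Θ″`".

This file proves the analytic half, on the universal cover `ℂ^{n₁+n₂} = ℂ^{n₁} × ℂ^{n₂}`
(`z₁ = z ∘ Fin.castAdd n₂`, `z₂ = z ∘ Fin.natAdd n₁`, i.e. `z = Fin.append z₁ z₂`):

* `riemannThetaTerm_blockDiag` — the general term factorises, `m = (m₁, m₂)`: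
  `exp(πi ᵗm(Ω₁ ⊕ Ω₂)m + 2πi ᵗmz) = exp(πi ᵗm₁Ω₁m₁ + 2πi ᵗm₁z₁) · exp(πi ᵗm₂Ω₂m₂ + 2πi ᵗm₂z₂)`;
* **`riemannTheta_blockDiag`** — `ϑ(z, Ω₁ ⊕ Ω₂) = ϑ(z₁, Ω₁) · ϑ(z₂, Ω₂)` (Fubini over
  `ℤ^{n₁+n₂} = ℤ^{n₁} × ℤ^{n₂}`, `Fin.appendEquiv`, for the absolutely convergent series,
  Mathlib's `tsum_mul_tsum_of_summable_norm`), and `riemannTheta_blockDiag_append`;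
* **`riemannTheta_blockDiag_eq_zero_iff`** — `ϑ(z, Ω₁ ⊕ Ω₂) = 0 ↔ ϑ(z₁, Ω₁) = 0 ∨ ϑ(z₂, Ω₂) = 0`:
  on the cover, `π⁻¹Θ = (π₁⁻¹Θ₁ × ℂ^{n₂}) ∪ (ℂ^{n₁} × π₂⁻¹Θ₂)` — "`Θ = (Θ′ × A″) ∪ (A′ × Θ″)` is reducible";
* **`hasFDerivAt_riemannTheta_blockDiag_zero`** — if `ϑ(z₁, Ω₁) = 0` and `ϑ(z₂, Ω₂) = 0` then `ϑ(·, Ω₁ ⊕ Ω₂)`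
  vanishes at `z` TOGETHER WITH ITS DIFFERENTIAL (multiplicity `≥ 2`): "`Sing Θ` contains `Θ′ × Θ″`";
* the Siegel-space bookkeeping: `blockDiag_symm` (`ᵗ(Ω₁ ⊕ Ω₂) = Ω₁ ⊕ Ω₂`), `im_blockDiag`,
  `posDef_im_blockDiag` (`Im(Ω₁ ⊕ Ω₂) ≻ 0`), so that `Ω₁ ⊕ Ω₂ ∈ ℌ_{n₁+n₂}`.

The torus-level statement `Θ = p₁⁻¹Θ₁ ∪ p₂⁻¹Θ₂` on `X_{Ω₁ ⊕ Ω₂}` is the sequel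
`Literature/Geometry/Kaehler/SiegelTorusThetaDivisorProduct.lean`. Theorems only; no definitions, no
named facts, net debt `0`. (The converse — `Θ` irreducible for an indecomposable ppav — is Igusa's
theorem and is NOT here.)

## References

* [GrushevskyXie2025] S. Grushevsky, Y. Xie, *Integrable systems approach to the Schottky problem and
  related questions*, arXiv:2504.20243 (2025), Remark 6.2 (held text `paper:arxiv-2504.20243`, p0034).
* [Lange2023AbelianVarietiesComplex] H. Lange, *Abelian Varieties over the Complex Numbers* (2023),
  §2.1.4 Exercise (7) (product of elliptic curves), Cor. 2.4.24 (product polarisation).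
* [MumfordTata1] D. Mumford, *Tata Lectures on Theta I* (1983), Ch. II §1 (`ϑ(z, Ω)`).
-/

noncomputable section

open Complex Real Filter Topology
open scoped Matrix

namespace Literature.Analysis.SpecialFunctions

variable {n₁ n₂ : ℕ}

-- Throughout, the decomposable period matrix `Ω₁ ⊕ Ω₂ = (Ω₁ 0; 0 Ω₂)` indexed by `Fin (n₁ + n₂)` is
-- spelled `Matrix.reindex finSumFinEquiv finSumFinEquiv (Matrix.fromBlocks Ω₁ 0 0 Ω₂)` (no notation,
-- no definition).

/-! ### The block-diagonal period matrix -/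

section Blocks

variable {R : Type*} [Zero R] (Ω₁ : Matrix (Fin n₁) (Fin n₁) R) (Ω₂ : Matrix (Fin n₂) (Fin n₂) R)

/-- The `(1,1)` block: `(Ω₁ ⊕ Ω₂)(i, j) = Ω₁(i, j)` on `Fin n₁ × Fin n₁`.
[cite: GrushevskyXie2025, Remark 6.2 (p0034)] -/
@[simp] theorem blockDiag_apply_castAdd_castAdd (i j : Fin n₁) :
    Matrix.reindex finSumFinEquiv finSumFinEquiv (Matrix.fromBlocks Ω₁ 0 0 Ω₂)
      (Fin.castAdd n₂ i) (Fin.castAdd n₂ j) = Ω₁ i j := by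
  simp [Matrix.reindex_apply]

/-- The `(2,2)` block: `(Ω₁ ⊕ Ω₂)(n₁ + i, n₁ + j) = Ω₂(i, j)`.
[cite: GrushevskyXie2025, Remark 6.2 (p0034)] -/
@[simp] theorem blockDiag_apply_natAdd_natAdd (i j : Fin n₂) :
    Matrix.reindex finSumFinEquiv finSumFinEquiv (Matrix.fromBlocks Ω₁ 0 0 Ω₂)
      (Fin.natAdd n₁ i) (Fin.natAdd n₁ j) = Ω₂ i j := by
  simp [Matrix.reindex_apply]

/-- The off-diagonal blocks vanish: `(Ω₁ ⊕ Ω₂)(i, n₁ + j) = 0`.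
[cite: GrushevskyXie2025, Remark 6.2 (p0034)] -/
@[simp] theorem blockDiag_apply_castAdd_natAdd (i : Fin n₁) (j : Fin n₂) :
    Matrix.reindex finSumFinEquiv finSumFinEquiv (Matrix.fromBlocks Ω₁ 0 0 Ω₂)
      (Fin.castAdd n₂ i) (Fin.natAdd n₁ j) = 0 := by
  simp [Matrix.reindex_apply]

/-- The off-diagonal blocks vanish: `(Ω₁ ⊕ Ω₂)(n₁ + i, j) = 0`.
[cite: GrushevskyXie2025, Remark 6.2 (p0034)] -/
@[simp] theorem blockDiag_apply_natAdd_castAdd (i : Fin n₂) (j : Fin n₁) :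
    Matrix.reindex finSumFinEquiv finSumFinEquiv (Matrix.fromBlocks Ω₁ 0 0 Ω₂)
      (Fin.natAdd n₁ i) (Fin.castAdd n₂ j) = 0 := by
  simp [Matrix.reindex_apply]

end Blocks

/-! ### `Ω₁ ⊕ Ω₂` lies in the Siegel upper half space -/

section Siegel

variable (Ω₁ : Matrix (Fin n₁) (Fin n₁) ℂ) (Ω₂ : Matrix (Fin n₂) (Fin n₂) ℂ)

/-- **`Ω₁ ⊕ Ω₂` is symmetric** when `Ω₁` and `Ω₂` are. [cite: GrushevskyXie2025, Remark 6.2 (p0034)] -/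
theorem blockDiag_symm (hΩ₁ : ∀ i j, Ω₁ i j = Ω₁ j i) (hΩ₂ : ∀ i j, Ω₂ i j = Ω₂ j i)
    (i j : Fin (n₁ + n₂)) :
    Matrix.reindex finSumFinEquiv finSumFinEquiv (Matrix.fromBlocks Ω₁ 0 0 Ω₂) i j =
      Matrix.reindex finSumFinEquiv finSumFinEquiv (Matrix.fromBlocks Ω₁ 0 0 Ω₂) j i := by
  induction i using Fin.addCases with
  | left i =>
    induction j using Fin.addCases with
    | left j => rw [blockDiag_apply_castAdd_castAdd, blockDiag_apply_castAdd_castAdd, hΩ₁]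
    | right j => rw [blockDiag_apply_castAdd_natAdd, blockDiag_apply_natAdd_castAdd]
  | right i =>
    induction j using Fin.addCases with
    | left j => rw [blockDiag_apply_castAdd_natAdd, blockDiag_apply_natAdd_castAdd]
    | right j => rw [blockDiag_apply_natAdd_natAdd, blockDiag_apply_natAdd_natAdd, hΩ₂]

/-- **`Im(Ω₁ ⊕ Ω₂) = Im Ω₁ ⊕ Im Ω₂`.** [cite: GrushevskyXie2025, Remark 6.2 (p0034)] -/
theorem im_blockDiag :
    (Matrix.of fun i j ↦
        (Matrix.reindex finSumFinEquiv finSumFinEquiv (Matrix.fromBlocks Ω₁ 0 0 Ω₂) i j).im) =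
      Matrix.reindex finSumFinEquiv finSumFinEquiv
        (Matrix.fromBlocks (Matrix.of fun i j ↦ (Ω₁ i j).im) 0 0 (Matrix.of fun i j ↦ (Ω₂ i j).im)) := by
  ext i j
  induction i using Fin.addCases with
  | left i =>
    induction j using Fin.addCases with
    | left j => simp [Matrix.reindex_apply]
    | right j => simp [Matrix.reindex_apply]
  | right i =>
    induction j using Fin.addCases with
    | left j => simp [Matrix.reindex_apply]
    | right j => simp [Matrix.reindex_apply]

/-- A block-diagonal real matrix with positive definite blocks is positive definite (its quadratic form is
the sum of the two quadratic forms). [folklore] -/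
private theorem posDef_fromBlocks_zero {A : Matrix (Fin n₁) (Fin n₁) ℝ}
    {D : Matrix (Fin n₂) (Fin n₂) ℝ} (hA : A.PosDef) (hD : D.PosDef) : (Matrix.fromBlocks A 0 0 D).PosDef := by
  have hA' := Matrix.posDef_iff_dotProduct_mulVec.mp hA
  have hD' := Matrix.posDef_iff_dotProduct_mulVec.mp hD
  refine Matrix.posDef_iff_dotProduct_mulVec.mpr
    ⟨Matrix.IsHermitian.fromBlocks hA'.1 (by simp) hD'.1, fun x hx ↦ ?_⟩
  have hsplit : star x ⬝ᵥ (Matrix.fromBlocks A 0 0 D *ᵥ x) =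
      star (x ∘ Sum.inl) ⬝ᵥ (A *ᵥ (x ∘ Sum.inl)) + star (x ∘ Sum.inr) ⬝ᵥ (D *ᵥ (x ∘ Sum.inr)) := by
    rw [Matrix.fromBlocks_mulVec]
    simp [dotProduct, Fintype.sum_sum_type, Matrix.zero_mulVec]
  rw [hsplit]
  have h1 := hA.posSemidef.dotProduct_mulVec_nonneg (x ∘ Sum.inl)
  have h2 := hD.posSemidef.dotProduct_mulVec_nonneg (x ∘ Sum.inr)
  by_cases hl : x ∘ Sum.inl = 0
  · have hr : x ∘ Sum.inr ≠ 0 := by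
      intro hr
      apply hx
      funext k
      rcases k with k | k
      · exact congrFun hl k
      · exact congrFun hr k
    exact add_pos_of_nonneg_of_pos h1 (hD'.2 hr)
  · exact add_pos_of_pos_of_nonneg (hA'.2 hl) h2

/-- **`Im(Ω₁ ⊕ Ω₂) ≻ 0` when `Im Ω₁ ≻ 0` and `Im Ω₂ ≻ 0`**: the decomposable period matrix lies in the
Siegel upper half space `ℌ_{n₁+n₂}`. [cite: GrushevskyXie2025, Remark 6.2 (p0034)] -/
theorem posDef_im_blockDiag (hpos₁ : (Matrix.of fun i j ↦ (Ω₁ i j).im).PosDef)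
    (hpos₂ : (Matrix.of fun i j ↦ (Ω₂ i j).im).PosDef) :
    (Matrix.of fun i j ↦
      (Matrix.reindex finSumFinEquiv finSumFinEquiv (Matrix.fromBlocks Ω₁ 0 0 Ω₂) i j).im).PosDef := by
  rw [im_blockDiag, Matrix.reindex_apply]
  exact (posDef_fromBlocks_zero hpos₁ hpos₂).submatrix finSumFinEquiv.symm.injective

end Siegel

/-! ### The factorisation of the theta series -/

section Theta

variable (Ω₁ : Matrix (Fin n₁) (Fin n₁) ℂ) (Ω₂ : Matrix (Fin n₂) (Fin n₂) ℂ)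
  {Ω : Matrix (Fin (n₁ + n₂)) (Fin (n₁ + n₂)) ℂ}
  (hΩ : Ω = Matrix.reindex finSumFinEquiv finSumFinEquiv (Matrix.fromBlocks Ω₁ 0 0 Ω₂))

include hΩ in
/-- The quadratic form of `Ω = Ω₁ ⊕ Ω₂` splits: `ᵗmΩm = ᵗm₁Ω₁m₁ + ᵗm₂Ω₂m₂` for `m = (m₁, m₂)`.
[cite: GrushevskyXie2025, Remark 6.2 (p0034)] -/
theorem sum_sum_mul_blockDiag_mul (m : Fin (n₁ + n₂) → ℤ) :
    ∑ i, ∑ j, (m i : ℂ) * Ω i j * (m j : ℂ) =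
      (∑ i, ∑ j, (m (Fin.castAdd n₂ i) : ℂ) * Ω₁ i j * (m (Fin.castAdd n₂ j) : ℂ)) +
        ∑ i, ∑ j, (m (Fin.natAdd n₁ i) : ℂ) * Ω₂ i j * (m (Fin.natAdd n₁ j) : ℂ) := by
  subst hΩ
  rw [Fin.sum_univ_add]
  simp only [Fin.sum_univ_add, blockDiag_apply_castAdd_castAdd, blockDiag_apply_castAdd_natAdd,
    blockDiag_apply_natAdd_castAdd, blockDiag_apply_natAdd_natAdd, mul_zero, zero_mul,
    Finset.sum_const_zero, add_zero, zero_add]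

include hΩ in
/-- **The general term factorises** for `Ω = Ω₁ ⊕ Ω₂`, `m = (m₁, m₂)`, `z = (z₁, z₂)`:
`exp(πi ᵗmΩm + 2πi ᵗmz) = exp(πi ᵗm₁Ω₁m₁ + 2πi ᵗm₁z₁) · exp(πi ᵗm₂Ω₂m₂ + 2πi ᵗm₂z₂)`.
[cite: GrushevskyXie2025, Remark 6.2 (p0034)] -/
theorem riemannThetaTerm_blockDiag (z : Fin (n₁ + n₂) → ℂ) (m : Fin (n₁ + n₂) → ℤ) :
    riemannThetaTerm Ω z m =
      riemannThetaTerm Ω₁ (fun i ↦ z (Fin.castAdd n₂ i)) (fun i ↦ m (Fin.castAdd n₂ i)) *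
        riemannThetaTerm Ω₂ (fun i ↦ z (Fin.natAdd n₁ i)) (fun i ↦ m (Fin.natAdd n₁ i)) := by
  simp only [riemannThetaTerm, ← Complex.exp_add, sum_sum_mul_blockDiag_mul Ω₁ Ω₂ hΩ]
  congr 1
  rw [Fin.sum_univ_add (fun i ↦ (m i : ℂ) * z i)]
  ring

variable {Ω₁ Ω₂} {c₁ c₂ : ℝ} (hc₁ : 0 < c₁) (hc₂ : 0 < c₂)
  (hY₁ : ∀ x : Fin n₁ → ℝ, c₁ * ∑ i, x i ^ 2 ≤ ∑ i, ∑ j, x i * (Ω₁ i j).im * x j)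
  (hY₂ : ∀ x : Fin n₂ → ℝ, c₂ * ∑ i, x i ^ 2 ≤ ∑ i, ∑ j, x i * (Ω₂ i j).im * x j)

include hΩ hc₁ hc₂ hY₁ hY₂ in
/-- **`ϑ(z, Ω₁ ⊕ Ω₂) = ϑ(z₁, Ω₁) · ϑ(z₂, Ω₂)`** (`Im Ω₁ ≥ c₁ > 0`, `Im Ω₂ ≥ c₂ > 0`; `z₁ = z|_{ℂ^{n₁}}`,
`z₂ = z|_{ℂ^{n₂}}`): "the theta function is the product `θ(τ, z) = θ′(τ′, z′) · θ(τ″, z″)`" — Fubini for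
the absolutely convergent double series over `ℤ^{n₁+n₂} = ℤ^{n₁} × ℤ^{n₂}`.
[cite: GrushevskyXie2025, Remark 6.2 (p0034)] -/
theorem riemannTheta_blockDiag (z : Fin (n₁ + n₂) → ℂ) :
    riemannTheta Ω z =
      riemannTheta Ω₁ (fun i ↦ z (Fin.castAdd n₂ i)) * riemannTheta Ω₂ (fun i ↦ z (Fin.natAdd n₁ i)) := by
  set z₁ : Fin n₁ → ℂ := fun i ↦ z (Fin.castAdd n₂ i) with hz₁
  set z₂ : Fin n₂ → ℂ := fun i ↦ z (Fin.natAdd n₁ i) with hz₂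
  rw [riemannTheta, riemannTheta, riemannTheta,
    tsum_mul_tsum_of_summable_norm (summable_norm_riemannThetaTerm Ω₁ hc₁ hY₁ z₁)
      (summable_norm_riemannThetaTerm Ω₂ hc₂ hY₂ z₂),
    ← (Fin.appendEquiv n₁ n₂).tsum_eq fun m ↦ riemannThetaTerm Ω z m]
  refine tsum_congr fun p ↦ ?_
  rw [riemannThetaTerm_blockDiag Ω₁ Ω₂ hΩ]
  simp [hz₁, hz₂]

include hΩ hc₁ hc₂ hY₁ hY₂ in
/-- The same on appended vectors: `ϑ((z₁, z₂), Ω₁ ⊕ Ω₂) = ϑ(z₁, Ω₁) · ϑ(z₂, Ω₂)`.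
[cite: GrushevskyXie2025, Remark 6.2 (p0034)] -/
theorem riemannTheta_blockDiag_append (z₁ : Fin n₁ → ℂ) (z₂ : Fin n₂ → ℂ) :
    riemannTheta Ω (Fin.append z₁ z₂) = riemannTheta Ω₁ z₁ * riemannTheta Ω₂ z₂ := by
  rw [riemannTheta_blockDiag hΩ hc₁ hc₂ hY₁ hY₂]
  simp

include hΩ hc₁ hc₂ hY₁ hY₂ in
/-- The series of `Ω₁ ⊕ Ω₂` converges absolutely (the product family of two absolutely convergent
series). [cite: GrushevskyXie2025, Remark 6.2 (p0034)] -/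
theorem summable_norm_riemannThetaTerm_blockDiag (z : Fin (n₁ + n₂) → ℂ) :
    Summable fun m : Fin (n₁ + n₂) → ℤ ↦ ‖riemannThetaTerm Ω z m‖ := by
  have h := (summable_norm_riemannThetaTerm Ω₁ hc₁ hY₁ (fun i ↦ z (Fin.castAdd n₂ i))).mul_norm
    (summable_norm_riemannThetaTerm Ω₂ hc₂ hY₂ (fun i ↦ z (Fin.natAdd n₁ i)))
  refine (Fin.appendEquiv n₁ n₂).summable_iff.mp ?_
  refine h.congr fun p ↦ ?_
  simp only [Function.comp_apply, riemannThetaTerm_blockDiag Ω₁ Ω₂ hΩ]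
  simp

/-! ### The zero set: the theta divisor of a product is reducible -/

include hΩ hc₁ hc₂ hY₁ hY₂ in
/-- **`ϑ(z, Ω₁ ⊕ Ω₂) = 0 ↔ ϑ(z₁, Ω₁) = 0 ∨ ϑ(z₂, Ω₂) = 0`**: on the universal cover, the theta divisor
of the product `(X_{Ω₁}, Θ₁) × (X_{Ω₂}, Θ₂)` is `(π₁⁻¹Θ₁ × ℂ^{n₂}) ∪ (ℂ^{n₁} × π₂⁻¹Θ₂)` — "the theta divisor
`Θ = (Θ′ × A″) ∪ (A′ × Θ″)` is reducible". [cite: GrushevskyXie2025, Remark 6.2 (p0034)] -/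
theorem riemannTheta_blockDiag_eq_zero_iff (z : Fin (n₁ + n₂) → ℂ) :
    riemannTheta Ω z = 0 ↔
      riemannTheta Ω₁ (fun i ↦ z (Fin.castAdd n₂ i)) = 0 ∨
        riemannTheta Ω₂ (fun i ↦ z (Fin.natAdd n₁ i)) = 0 := by
  rw [riemannTheta_blockDiag hΩ hc₁ hc₂ hY₁ hY₂, mul_eq_zero]

include hΩ hc₁ hc₂ hY₁ hY₂ in
/-- `{ϑ(z₁, Ω₁) = 0} × ℂ^{n₂} ⊆ {ϑ(·, Ω₁ ⊕ Ω₂) = 0}`: the first component `Θ′ × A″`.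
[cite: GrushevskyXie2025, Remark 6.2 (p0034)] -/
theorem riemannTheta_blockDiag_eq_zero_of_left (z : Fin (n₁ + n₂) → ℂ)
    (h : riemannTheta Ω₁ (fun i ↦ z (Fin.castAdd n₂ i)) = 0) : riemannTheta Ω z = 0 :=
  (riemannTheta_blockDiag_eq_zero_iff hΩ hc₁ hc₂ hY₁ hY₂ z).mpr (Or.inl h)

include hΩ hc₁ hc₂ hY₁ hY₂ in
/-- `ℂ^{n₁} × {ϑ(z₂, Ω₂) = 0} ⊆ {ϑ(·, Ω₁ ⊕ Ω₂) = 0}`: the second component `A′ × Θ″`.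
[cite: GrushevskyXie2025, Remark 6.2 (p0034)] -/
theorem riemannTheta_blockDiag_eq_zero_of_right (z : Fin (n₁ + n₂) → ℂ)
    (h : riemannTheta Ω₂ (fun i ↦ z (Fin.natAdd n₁ i)) = 0) : riemannTheta Ω z = 0 :=
  (riemannTheta_blockDiag_eq_zero_iff hΩ hc₁ hc₂ hY₁ hY₂ z).mpr (Or.inr h)

/-! ### `Θ′ × Θ″ ⊆ Sing Θ`: the theta function vanishes to second order there -/

/-- The coordinate restriction `z ↦ z|_{ℂ^{n₁}}` (resp. `z|_{ℂ^{n₂}}`) is a continuous linear map.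
[folklore] -/
private theorem differentiable_restrict {k : ℕ} (e : Fin k → Fin (n₁ + n₂)) :
    Differentiable ℂ fun z : Fin (n₁ + n₂) → ℂ ↦ fun i ↦ z (e i) :=
  differentiable_pi.mpr fun i ↦ differentiable_apply (e i)

include hΩ hc₁ hc₂ hY₁ hY₂ in
/-- **On `Θ′ × Θ″` the theta function of the product vanishes together with its differential**
(`ϑ = ϑ₁ · ϑ₂` with both factors zero, Leibniz rule): the points of `π₁⁻¹Θ₁ × π₂⁻¹Θ₂` are zeros of
multiplicity `≥ 2` of `ϑ(·, Ω₁ ⊕ Ω₂)` — "the singular locus of the theta divisor `Sing Θ` contains a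
`(g − 2)`-dimensional subvariety `Θ′ × Θ″`". [cite: GrushevskyXie2025, Remark 6.2 (p0034)] -/
theorem hasFDerivAt_riemannTheta_blockDiag_zero (z : Fin (n₁ + n₂) → ℂ)
    (h₁ : riemannTheta Ω₁ (fun i ↦ z (Fin.castAdd n₂ i)) = 0)
    (h₂ : riemannTheta Ω₂ (fun i ↦ z (Fin.natAdd n₁ i)) = 0) :
    riemannTheta Ω z = 0 ∧
      HasFDerivAt (riemannTheta Ω) (0 : (Fin (n₁ + n₂) → ℂ) →L[ℂ] ℂ) z := by
  refine ⟨riemannTheta_blockDiag_eq_zero_of_left hΩ hc₁ hc₂ hY₁ hY₂ z h₁, ?_⟩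
  have hF : riemannTheta Ω = (fun z : Fin (n₁ + n₂) → ℂ ↦
      riemannTheta Ω₁ (fun i ↦ z (Fin.castAdd n₂ i))) *
        fun z ↦ riemannTheta Ω₂ (fun i ↦ z (Fin.natAdd n₁ i)) :=
    funext fun w ↦ by rw [Pi.mul_apply]; exact riemannTheta_blockDiag hΩ hc₁ hc₂ hY₁ hY₂ w
  have hd₁ : DifferentiableAt ℂ (fun z : Fin (n₁ + n₂) → ℂ ↦
      riemannTheta Ω₁ (fun i ↦ z (Fin.castAdd n₂ i))) z :=
    ((differentiable_riemannTheta Ω₁ hc₁ hY₁).comp (differentiable_restrict (Fin.castAdd n₂))) z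
  have hd₂ : DifferentiableAt ℂ (fun z : Fin (n₁ + n₂) → ℂ ↦
      riemannTheta Ω₂ (fun i ↦ z (Fin.natAdd n₁ i))) z :=
    ((differentiable_riemannTheta Ω₂ hc₂ hY₂).comp (differentiable_restrict (Fin.natAdd n₁))) z
  have h := (hd₁.hasFDerivAt.mul hd₂.hasFDerivAt).congr_fderiv
    (show _ = (0 : (Fin (n₁ + n₂) → ℂ) →L[ℂ] ℂ) from
      ContinuousLinearMap.ext fun v ↦ by simp [h₁, h₂])
  rw [hF]
  exact h

include hΩ hc₁ hc₂ hY₁ hY₂ in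
/-- In particular the GRADIENT vanishes on `Θ′ × Θ″`: `fderiv ϑ(·, Ω₁ ⊕ Ω₂) z = 0`.
[cite: GrushevskyXie2025, Remark 6.2 (p0034)] -/
theorem fderiv_riemannTheta_blockDiag_eq_zero (z : Fin (n₁ + n₂) → ℂ)
    (h₁ : riemannTheta Ω₁ (fun i ↦ z (Fin.castAdd n₂ i)) = 0)
    (h₂ : riemannTheta Ω₂ (fun i ↦ z (Fin.natAdd n₁ i)) = 0) :
    fderiv ℂ (riemannTheta Ω) z = 0 :=
  (hasFDerivAt_riemannTheta_blockDiag_zero hΩ hc₁ hc₂ hY₁ hY₂ z h₁ h₂).2.fderiv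

end Theta

/-! ### The hypotheses from `Im Ωᵢ ≻ 0` -/

section PosDef

variable {Ω₁ : Matrix (Fin n₁) (Fin n₁) ℂ} {Ω₂ : Matrix (Fin n₂) (Fin n₂) ℂ}
  {Ω : Matrix (Fin (n₁ + n₂)) (Fin (n₁ + n₂)) ℂ}
  (hΩ : Ω = Matrix.reindex finSumFinEquiv finSumFinEquiv (Matrix.fromBlocks Ω₁ 0 0 Ω₂))
  (hpos₁ : (Matrix.of fun i j ↦ (Ω₁ i j).im).PosDef) (hpos₂ : (Matrix.of fun i j ↦ (Ω₂ i j).im).PosDef)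

include hΩ hpos₁ hpos₂ in
/-- **`ϑ(z, Ω₁ ⊕ Ω₂) = ϑ(z₁, Ω₁) · ϑ(z₂, Ω₂)` for `Ω₁ ∈ ℌ_{n₁}`, `Ω₂ ∈ ℌ_{n₂}`** (the hypotheses
`Im Ωᵢ ≥ cᵢ > 0` of `riemannTheta_blockDiag` from positive definiteness).
[cite: GrushevskyXie2025, Remark 6.2 (p0034)] -/
theorem riemannTheta_blockDiag_of_posDef (z : Fin (n₁ + n₂) → ℂ) :
    riemannTheta Ω z =
      riemannTheta Ω₁ (fun i ↦ z (Fin.castAdd n₂ i)) * riemannTheta Ω₂ (fun i ↦ z (Fin.natAdd n₁ i)) := by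
  obtain ⟨c₁, hc₁, hY₁⟩ := exists_pos_mul_sum_sq_le_of_posDef_im Ω₁ hpos₁
  obtain ⟨c₂, hc₂, hY₂⟩ := exists_pos_mul_sum_sq_le_of_posDef_im Ω₂ hpos₂
  exact riemannTheta_blockDiag hΩ hc₁ hc₂ hY₁ hY₂ z

include hΩ hpos₁ hpos₂ in
/-- **`ϑ(z, Ω₁ ⊕ Ω₂) = 0 ↔ ϑ(z₁, Ω₁) = 0 ∨ ϑ(z₂, Ω₂) = 0`** for `Ωᵢ` in the Siegel upper half spaces.
[cite: GrushevskyXie2025, Remark 6.2 (p0034)] -/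
theorem riemannTheta_blockDiag_eq_zero_iff_of_posDef (z : Fin (n₁ + n₂) → ℂ) :
    riemannTheta Ω z = 0 ↔
      riemannTheta Ω₁ (fun i ↦ z (Fin.castAdd n₂ i)) = 0 ∨
        riemannTheta Ω₂ (fun i ↦ z (Fin.natAdd n₁ i)) = 0 := by
  rw [riemannTheta_blockDiag_of_posDef hΩ hpos₁ hpos₂, mul_eq_zero]

include hΩ hpos₁ hpos₂ in
/-- **`Θ′ × Θ″ ⊆ Sing Θ`** for `Ωᵢ` in the Siegel upper half spaces: at a common zero of `ϑ(·, Ω₁)` and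
`ϑ(·, Ω₂)` the theta function of `Ω₁ ⊕ Ω₂` vanishes with zero differential.
[cite: GrushevskyXie2025, Remark 6.2 (p0034)] -/
theorem hasFDerivAt_riemannTheta_blockDiag_zero_of_posDef (z : Fin (n₁ + n₂) → ℂ)
    (h₁ : riemannTheta Ω₁ (fun i ↦ z (Fin.castAdd n₂ i)) = 0)
    (h₂ : riemannTheta Ω₂ (fun i ↦ z (Fin.natAdd n₁ i)) = 0) :
    riemannTheta Ω z = 0 ∧
      HasFDerivAt (riemannTheta Ω) (0 : (Fin (n₁ + n₂) → ℂ) →L[ℂ] ℂ) z := by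
  obtain ⟨c₁, hc₁, hY₁⟩ := exists_pos_mul_sum_sq_le_of_posDef_im Ω₁ hpos₁
  obtain ⟨c₂, hc₂, hY₂⟩ := exists_pos_mul_sum_sq_le_of_posDef_im Ω₂ hpos₂
  exact hasFDerivAt_riemannTheta_blockDiag_zero hΩ hc₁ hc₂ hY₁ hY₂ z h₁ h₂

end PosDef

end Literature.Analysis.SpecialFunctions

end
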